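import Summits.KontsevichZagierPeriods.Zeta5Search.RVCasoratianNormalForm
import HarnessLib

/-!
# fam-rv 14.2 — `RVJetShift`: the harmonic-free minor `Q(b)` is an invariant of the common logarithmic-jet group

HONEST FRAMING: systematic search; no irrationality claim unless certified.  Pure algebra of truncated partial-fraction data (six
orders `o < 6` per pole, as everywhere in this cell): identities between rational numbers, valid for ARBITRARY data `c : ℕ → ℕ → ℚ`;
the one place the cell's functions enter (Part C) is the VANISHING OF THE EVEN-ZETA COEFFICIENTS (`WedgeDictionary.sum_pfData_odd`,
the well-poised reflection) for `R_b` and — through 13.1's transport `isPFData_shift` — for its partner-free core.  Nothing here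
concerns integrals, sizes, denominators or irrationality; Δγ = 0.

## The operators
`∂` is the ORDER-RAISING operator `(∂c)_{o,q} = c_{o+1,q}` of truncated data (order `6` read as `0`).  Part A studies
`jetShift2 τ = exp(τ∂²)`: `c_{o,q} ↦ c_{o,q} + τ·c_{o+2,q} + (τ²/2)·c_{o+4,q}`; Part C the general truncated jet operator
`jetOp t = T_t = Σ_k t_k ∂^k`, `(T_t c)_{o,q} = Σ_{k<6−o} t_k c_{o+k,q}` (`exp(τ∂²) = T_{(1,0,τ,0,τ²/2,0)}`, `jetOp_eq_jetShift2`).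
MEANING (dictionary deferred to a later file; not used in any proof): if at every pole `q` the data are the Laurent coefficients of
`u^{-d_q}·A_q·exp(Σ_k λ_k(q) u^k)` — as the data `pfData b` of the cell's rational functions `R_b` are, with
`λ_k(q) = Σ_a m(a)(−1)^{k+1}/(k(a−q−1)^k)` over the linear factors `(t+a)^{m(a)}` of `R_b` — then `∂_{λ_k} c_{o,q} = c_{o+k,q}`, so
`T_t` with `t` = the series coefficients of `exp(Σ_k s_k ∂^k)` is the SIMULTANEOUS SHIFT `λ_k(q) ↦ λ_k(q) + s_k` of every logarithmic
jet at every pole: the "common jet" group.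

## Content (all PROVED; no typed node)
* Part A — `jetShift2_zero`, `jetShift2_add` (one-parameter group); `linMul_jetShift2`, `shiftData_jetShift2` (it commutes with the
  13.1 transports — all are polynomials in `∂`); `rawSum_four_jetShift2` (`U` FIXED), `rawSum_two_jetShift2` (`W ↦ W + τU`), the same for
  the cores; hence `topEigen_jetShift2` (`r_U = U^core/U` fixed), **`rawMinorQ_jetShift2`** (`Q(exp(τ∂²)c) = Q(c)`, NO hypothesis) and
  `rawDeflW_jetShift2` (the deflated `W`-sum `D = W^core − r_U·W`, `U ≠ 0`).
* Part B — bridges to the cell's functionals (`coeffU_eq_rawSum`, `coeffW_eq_rawSum`, `coreUW_eq_rawSum`, `minorQCore_eq_rawMinorQ`, all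
  `rfl`) and `minorQCore_jetShift2_invariant`.
* Part C — `jetOp`: `linMul_jetOp`, `shiftData_jetOp`; `rawSum_four_jetOp` (`U ↦ t₀U + t₁S₅`), `rawSum_two_jetOp`
  (`W ↦ t₀W + t₁S₃ + t₂U + t₃S₅`, `S₃, S₅` = the `ζ(4)`, `ζ(6)` coefficient sums); `rawMinorQ_jetOp` (`Q(T_t c) = t₀²Q(c)` given vanishing
  odd sums of `c` and of its core), `rawMinorQ_jetOp_even` (no hypothesis for even operators), `rawDeflW_jetOp`; the hypotheses HOLD on the
  polytope with one admissible partner: `rawSum_pfData_odd`, `rawSum_coreData_odd`; hence **`minorQCore_jetOp_invariant`**: for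
  `InPolytope b` with a partner and EVERY `t`, `Q` computed from `T_t(pfData b)` is `t₀²·minorQCore b`; `coeffU_jetOp`, `deflW_jetOp_invariant`.

## Why the line wants this (gen 14 HANDOFF §G15-PREP; exact numerics `pub-zeta5-fam-rv/gen14/{logjet15,fastfun15,famX15b}.py`)
Termwise, `W^core` and `r_U·W` each carry the common second jet `Λ₂` of the window poles (an `H^{(2)}`-type sum with `v_p(Λ₂) = −2`
on zone C); the `needed` digits of the pivot law (PQ) of 14.1 that no additive regrouping of gens 11–13 certifies are the cancellation
of the common jets in `Q = U·D` — which this file shows is EXACT: `Q(b)` is a function of the data MODULO the common jet group.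
Consequence recorded there (OBSERVED, not formalised here): on every uniform affine family `b(p)` of zone C the normalised deflated sum
`D/A_{q*}` is a rational function of `p` (jet DIFFERENCES telescope), e.g. `−2(p+3)(p+4)(p+5)/((p+1)(p+2)(7p+15))` on
`(2p+2; p+1, p, p, p, p; 0, 0)`, so `v_p(D)` is decided per family by its order at `p = 0`.

Provenance: planner seat `planner-pub-zeta5-fam-rv-g14-0` (unit `pub-zeta5-fam-rv-g14`).
-/

noncomputable section

open Finset

namespace Summit.KontsevichZagierPeriods.Zeta5Search.RVFlatGauge

open Summit.KontsevichZagierPeriods.Zeta5Search.DualSeries (InBox)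
open Summit.KontsevichZagierPeriods.Zeta5Search.WedgeDictionary (IsPFData pfData isPFData_pfData exists_isPFData sum_pfData_odd
  coeffU coeffW)
open Summit.KontsevichZagierPeriods.Zeta5Search.CasoratianValuation (shift InPolytope)
open Summit.KontsevichZagierPeriods.Zeta5Search.BigPrime (shift_zero polytope_hyps)

/-! ## Part A — the operator `exp(τ ∂²)` on truncated data -/

/-- `exp(τ∂²)` on six-order data: `c_{o,q} ↦ c_{o,q} + τ c_{o+2,q} + (τ²/2) c_{o+4,q}`, indices `≥ 6` read as `0`. -/
def jetShift2 (τ : ℚ) (c : ℕ → ℕ → ℚ) (o q : ℕ) : ℚ :=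
  c o q + τ * (if o < 4 then c (o + 2) q else 0) + τ ^ 2 / 2 * (if o < 2 then c (o + 4) q else 0)

/-- `exp(0·∂²) = id`. -/
@[simp] theorem jetShift2_zero (c : ℕ → ℕ → ℚ) : jetShift2 0 c = c := by
  funext o q
  simp [jetShift2]

/-- ONE-PARAMETER GROUP: `exp(σ∂²) ∘ exp(τ∂²) = exp((σ+τ)∂²)` on six orders. -/
theorem jetShift2_add (σ τ : ℚ) (c : ℕ → ℕ → ℚ) : jetShift2 σ (jetShift2 τ c) = jetShift2 (σ + τ) c := by
  funext o q
  simp only [jetShift2]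
  split_ifs <;> first | (exfalso; omega) | ring

/-- `exp(τ∂²)` commutes with the transport `linMul a` along multiplication by a linear factor (both are polynomials in `∂`). -/
theorem linMul_jetShift2 (a τ : ℚ) (c : ℕ → ℕ → ℚ) : linMul a (jetShift2 τ c) = jetShift2 τ (linMul a c) := by
  funext o q
  simp only [linMul, jetShift2]
  split_ifs <;> first | (exfalso; omega) | ring

/-- `exp(τ∂²)` commutes with the quadratic transport `shiftData n m` of 13.1. -/
theorem shiftData_jetShift2 (n m τ : ℚ) (c : ℕ → ℕ → ℚ) :
    shiftData n m (jetShift2 τ c) = jetShift2 τ (shiftData n m c) := by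
  unfold shiftData
  rw [linMul_jetShift2, linMul_jetShift2]

/-! ## Part B — raw coefficient functionals, the `Q`-minor of arbitrary data, bridges -/

/-- The order-`o` coefficient functional of raw data: `Σ_{q ≤ N} c_{o,q}`. -/
def rawSum (N o : ℕ) (c : ℕ → ℕ → ℚ) : ℚ := ∑ q ∈ range (N + 1), c o q

/-- The TOP functional (`o = 4`, the `ζ(5)`-coefficient) is FIXED by `exp(τ∂²)`. -/
theorem rawSum_four_jetShift2 (N : ℕ) (τ : ℚ) (c : ℕ → ℕ → ℚ) : rawSum N 4 (jetShift2 τ c) = rawSum N 4 c := by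
  unfold rawSum jetShift2
  exact sum_congr rfl fun q _ => by norm_num

/-- The `ζ(3)`-coefficient functional (`o = 2`) moves by `τ` times the top functional. -/
theorem rawSum_two_jetShift2 (N : ℕ) (τ : ℚ) (c : ℕ → ℕ → ℚ) :
    rawSum N 2 (jetShift2 τ c) = rawSum N 2 c + τ * rawSum N 4 c := by
  unfold rawSum jetShift2
  rw [mul_sum, ← sum_add_distrib]
  exact sum_congr rfl fun q _ => by norm_num

/-- The `Q`-minor of arbitrary data with the partner-free multiplier `y(y+n)`: `U·W^core − U^core·W`. -/
def rawMinorQ (N : ℕ) (n : ℚ) (c : ℕ → ℕ → ℚ) : ℚ :=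
  rawSum N 4 c * rawSum N 2 (shiftData n 0 c) - rawSum N 4 (shiftData n 0 c) * rawSum N 2 c

/-- The DEFLATED `W`-functional of arbitrary data: `W^core − (U^core/U)·W` (junk `U^core/0 = 0` when `U = 0`). -/
def rawDeflW (N : ℕ) (n : ℚ) (c : ℕ → ℕ → ℚ) : ℚ :=
  rawSum N 2 (shiftData n 0 c) - rawSum N 4 (shiftData n 0 c) / rawSum N 4 c * rawSum N 2 c

/-- The core top functional `U^core` is FIXED by `exp(τ∂²)`. -/
theorem rawSum_four_core_jetShift2 (N : ℕ) (n τ : ℚ) (c : ℕ → ℕ → ℚ) :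
    rawSum N 4 (shiftData n 0 (jetShift2 τ c)) = rawSum N 4 (shiftData n 0 c) := by
  rw [shiftData_jetShift2, rawSum_four_jetShift2]

/-- The top eigenvalue `r_U = U^core/U` is FIXED by `exp(τ∂²)`. -/
theorem topEigen_jetShift2 (N : ℕ) (n τ : ℚ) (c : ℕ → ℕ → ℚ) :
    rawSum N 4 (shiftData n 0 (jetShift2 τ c)) / rawSum N 4 (jetShift2 τ c)
      = rawSum N 4 (shiftData n 0 c) / rawSum N 4 c := by
  rw [rawSum_four_core_jetShift2, rawSum_four_jetShift2]

/-- **`Q` does not see the common second jet**: `Q(exp(τ∂²) c) = Q(c)` for all data `c` and all `τ`. -/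
theorem rawMinorQ_jetShift2 (N : ℕ) (n τ : ℚ) (c : ℕ → ℕ → ℚ) :
    rawMinorQ N n (jetShift2 τ c) = rawMinorQ N n c := by
  simp only [rawMinorQ, shiftData_jetShift2, rawSum_four_jetShift2, rawSum_two_jetShift2]
  ring

/-- **The deflated `W`-functional does not see the common second jet** (for `U ≠ 0`). -/
theorem rawDeflW_jetShift2 (N : ℕ) (n τ : ℚ) (c : ℕ → ℕ → ℚ) (hU : rawSum N 4 c ≠ 0) :
    rawDeflW N n (jetShift2 τ c) = rawDeflW N n c := by
  simp only [rawDeflW, shiftData_jetShift2, rawSum_four_jetShift2, rawSum_two_jetShift2]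
  field_simp
  ring

/-! ### Bridges to the cell's functionals -/

/-- `U(b)` is the raw top functional of `pfData b` (definitional). -/
theorem coeffU_eq_rawSum (b : ℕ → ℤ) : coeffU b = rawSum (b 0).toNat 4 (pfData b) := rfl

/-- `W(b)` is the raw order-`2` functional of `pfData b` (definitional). -/
theorem coeffW_eq_rawSum (b : ℕ → ℤ) : coeffW b = rawSum (b 0).toNat 2 (pfData b) := rfl

/-- `U^core(b)`, `W^core(b)` are the raw functionals of the transported data (definitional). -/
theorem coreUW_eq_rawSum (b : ℕ → ℤ) :
    coreU b = rawSum (b 0).toNat 4 (shiftData (b 0) 0 (pfData b)) ∧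
      coreW b = rawSum (b 0).toNat 2 (shiftData (b 0) 0 (pfData b)) := ⟨rfl, rfl⟩

/-- `minorQCore b` is the raw `Q`-minor of `pfData b` (definitional). -/
theorem minorQCore_eq_rawMinorQ (b : ℕ → ℤ) : minorQCore b = rawMinorQ (b 0).toNat (b 0) (pfData b) := rfl

/-- **`Q(b)` is a function of the data modulo the one-parameter group `exp(τ∂²)`**: replacing `pfData b` by
`exp(τ∂²)(pfData b)` in its definition does not change `minorQCore b`. -/
theorem minorQCore_jetShift2_invariant (b : ℕ → ℤ) (τ : ℚ) :
    rawMinorQ (b 0).toNat (b 0) (jetShift2 τ (pfData b)) = minorQCore b := by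
  rw [rawMinorQ_jetShift2, minorQCore_eq_rawMinorQ]

/-! ## Part C — the full truncated jet group `T_t = Σ_k t_k ∂^k` -/

/-- `T_t = Σ_k t_k ∂^k` on six-order data: `(T_t c)_{o,q} = Σ_{k < 6−o} t_k c_{o+k,q}` for `o < 6` (identity on the unused orders `o ≥ 6`). -/
def jetOp (t : ℕ → ℚ) (c : ℕ → ℕ → ℚ) (o q : ℕ) : ℚ :=
  if o < 6 then ∑ k ∈ range (6 - o), t k * c (o + k) q else c o q

/-- Order `5`: `(T_t c)_5 = t₀ c_5`. -/
theorem jetOp_five (t : ℕ → ℚ) (c : ℕ → ℕ → ℚ) (q : ℕ) : jetOp t c 5 q = t 0 * c 5 q := by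
  simp [jetOp]

/-- Order `4`: `(T_t c)_4 = t₀ c_4 + t₁ c_5`. -/
theorem jetOp_four (t : ℕ → ℚ) (c : ℕ → ℕ → ℚ) (q : ℕ) : jetOp t c 4 q = t 0 * c 4 q + t 1 * c 5 q := by
  simp [jetOp, sum_range_succ]

/-- Order `3`: `(T_t c)_3 = t₀ c_3 + t₁ c_4 + t₂ c_5`. -/
theorem jetOp_three (t : ℕ → ℚ) (c : ℕ → ℕ → ℚ) (q : ℕ) : jetOp t c 3 q = t 0 * c 3 q + t 1 * c 4 q + t 2 * c 5 q := by
  simp [jetOp, sum_range_succ]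

/-- Order `2`: `(T_t c)_2 = t₀ c_2 + t₁ c_3 + t₂ c_4 + t₃ c_5`. -/
theorem jetOp_two (t : ℕ → ℚ) (c : ℕ → ℕ → ℚ) (q : ℕ) :
    jetOp t c 2 q = t 0 * c 2 q + t 1 * c 3 q + t 2 * c 4 q + t 3 * c 5 q := by
  simp [jetOp, sum_range_succ]

/-- `exp(τ∂²)` of Part A is the jet operator with `t = (1, 0, τ, 0, τ²/2, 0)`. -/
theorem jetOp_eq_jetShift2 (τ : ℚ) (c : ℕ → ℕ → ℚ) :
    jetOp (fun k => if k = 0 then 1 else if k = 2 then τ else if k = 4 then τ ^ 2 / 2 else 0) c = jetShift2 τ c := by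
  funext o q
  rcases Nat.lt_or_ge o 6 with ho | ho
  · interval_cases o <;> simp [jetOp, jetShift2, sum_range_succ]
  · simp [jetOp, jetShift2, show ¬o < 6 by omega, show ¬o < 4 by omega, show ¬o < 2 by omega]

/-- `T_t` commutes with the linear transport `linMul a` (both are polynomials in `∂` with the same truncation). -/
theorem linMul_jetOp (a : ℚ) (t : ℕ → ℚ) (c : ℕ → ℕ → ℚ) : linMul a (jetOp t c) = jetOp t (linMul a c) := by
  funext o q
  rcases Nat.lt_or_ge o 6 with ho | ho
  · interval_cases o <;> simp [jetOp, linMul, sum_range_succ] <;> ring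
  · simp [jetOp, linMul, show ¬o < 6 by omega, show ¬o < 5 by omega]

/-- `T_t` commutes with the quadratic transport `shiftData n m`. -/
theorem shiftData_jetOp (n m : ℚ) (t : ℕ → ℚ) (c : ℕ → ℕ → ℚ) :
    shiftData n m (jetOp t c) = jetOp t (shiftData n m c) := by
  unfold shiftData
  rw [linMul_jetOp, linMul_jetOp]

/-! ### How the coefficient functionals move -/

/-- `U(T_t c) = t₀ U + t₁ S₅`. -/
theorem rawSum_four_jetOp (N : ℕ) (t : ℕ → ℚ) (c : ℕ → ℕ → ℚ) :
    rawSum N 4 (jetOp t c) = t 0 * rawSum N 4 c + t 1 * rawSum N 5 c := by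
  simp only [rawSum, jetOp_four, sum_add_distrib, mul_sum]

/-- `W(T_t c) = t₀ W + t₁ S₃ + t₂ U + t₃ S₅`. -/
theorem rawSum_two_jetOp (N : ℕ) (t : ℕ → ℚ) (c : ℕ → ℕ → ℚ) :
    rawSum N 2 (jetOp t c) = t 0 * rawSum N 2 c + t 1 * rawSum N 3 c + t 2 * rawSum N 4 c + t 3 * rawSum N 5 c := by
  simp only [rawSum, jetOp_two, sum_add_distrib, mul_sum]

/-- **`Q(T_t c) = t₀²·Q(c)`** whenever the odd-order sums (`ζ(4)`, `ζ(6)` coefficients) of `c` and of its core vanish. -/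
theorem rawMinorQ_jetOp (N : ℕ) (n : ℚ) (t : ℕ → ℚ) (c : ℕ → ℕ → ℚ) (h3 : rawSum N 3 c = 0) (h5 : rawSum N 5 c = 0)
    (h3c : rawSum N 3 (shiftData n 0 c) = 0) (h5c : rawSum N 5 (shiftData n 0 c) = 0) :
    rawMinorQ N n (jetOp t c) = t 0 ^ 2 * rawMinorQ N n c := by
  simp only [rawMinorQ, shiftData_jetOp, rawSum_four_jetOp, rawSum_two_jetOp, h3, h5, h3c, h5c]
  ring

/-- EVEN operators (`t₁ = t₃ = 0`, e.g. `exp(τ₂∂² + τ₄∂⁴)`) need no hypothesis: `Q(T_t c) = t₀²·Q(c)` for all data. -/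
theorem rawMinorQ_jetOp_even (N : ℕ) (n : ℚ) (t : ℕ → ℚ) (c : ℕ → ℕ → ℚ) (h1 : t 1 = 0) (h3 : t 3 = 0) :
    rawMinorQ N n (jetOp t c) = t 0 ^ 2 * rawMinorQ N n c := by
  simp only [rawMinorQ, shiftData_jetOp, rawSum_four_jetOp, rawSum_two_jetOp, h1, h3]
  ring

/-- **The deflated `W`-sum is invariant**: `D(T_t c) = D(c)` for `t₀ = 1`, `U ≠ 0`, odd sums vanishing. -/
theorem rawDeflW_jetOp (N : ℕ) (n : ℚ) (t : ℕ → ℚ) (c : ℕ → ℕ → ℚ) (ht : t 0 = 1) (hU : rawSum N 4 c ≠ 0)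
    (h3 : rawSum N 3 c = 0) (h5 : rawSum N 5 c = 0) (h3c : rawSum N 3 (shiftData n 0 c) = 0)
    (h5c : rawSum N 5 (shiftData n 0 c) = 0) : rawDeflW N n (jetOp t c) = rawDeflW N n c := by
  simp only [rawDeflW, shiftData_jetOp, rawSum_four_jetOp, rawSum_two_jetOp, h3, h5, h3c, h5c, ht, one_mul, mul_zero,
    add_zero]
  have key : rawSum N 4 (shiftData n 0 c) / rawSum N 4 c * rawSum N 4 c = rawSum N 4 (shiftData n 0 c) :=
    div_mul_cancel₀ _ hU
  linear_combination (-(t 2)) * key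

/-! ### The vanishing hypotheses hold on the polytope -/

/-- Odd-order sums of `pfData b` vanish on the polytope (`ζ(2)`, `ζ(4)`, `ζ(6)` carry nothing; `WedgeDictionary.sum_pfData_odd`). -/
theorem rawSum_pfData_odd (b : ℕ → ℤ) (hb : InPolytope b) {o : ℕ} (ho : o < 6) (hodd : Odd o) :
    rawSum (b 0).toNat o (pfData b) = 0 := by
  obtain ⟨hbox, -, hsum⟩ := polytope_hyps b hb
  obtain ⟨c, hc⟩ := exists_isPFData b hbox hsum
  exact sum_pfData_odd b hbox (isPFData_pfData hc) ho hodd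

/-- Odd-order sums of the CORE data vanish on the polytope with one admissible partner `b + e_j`
(transport 13.1: the data of `R_{b+e_j}` are `shiftData b₀ b_j (pfData b) = core + b_j(b₀ − b_j)·pfData b`). -/
theorem rawSum_coreData_odd (b : ℕ → ℤ) (hb : InPolytope b) (hj : ∃ j, 1 ≤ j ∧ j ≤ 7 ∧ InPolytope (shift b j))
    {o : ℕ} (ho : o < 6) (hodd : Odd o) : rawSum (b 0).toNat o (shiftData (b 0) 0 (pfData b)) = 0 := by
  obtain ⟨hbox, -, hsum⟩ := polytope_hyps b hb
  obtain ⟨j, hj1, hj7, hbj⟩ := hj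
  obtain ⟨hbox', -, -⟩ := polytope_hyps _ hbj
  obtain ⟨c, hc⟩ := exists_isPFData b hbox hsum
  have hs := isPFData_shift b hbox hsum hj1 hj7 (isPFData_pfData hc)
  have hodd' := sum_pfData_odd (shift b j) hbox' hs ho hodd
  rw [shift_zero b hj1] at hodd'
  have hb' := rawSum_pfData_odd b hb ho hodd
  unfold rawSum at hb' ⊢
  have key : ∀ q, shiftData ((b 0 : ℤ) : ℚ) 0 (pfData b) o q =
      shiftData ((b 0 : ℤ) : ℚ) (b j) (pfData b) o q - (b j : ℚ) * ((b 0 : ℤ) - (b j : ℚ)) * pfData b o q := by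
    intro q
    rw [shiftData_eq ((b 0 : ℤ) : ℚ) (b j) (pfData b) o q]
    ring
  simp_rw [key, sum_sub_distrib, ← mul_sum, hodd', hb', mul_zero, sub_zero]

/-! ### The invariance theorems for the cell's functionals -/

/-- `U(b)` from jet-moved data: `t₀·U(b)`. -/
theorem coeffU_jetOp (b : ℕ → ℤ) (hb : InPolytope b) (t : ℕ → ℚ) :
    rawSum (b 0).toNat 4 (jetOp t (pfData b)) = t 0 * coeffU b := by
  rw [rawSum_four_jetOp, rawSum_pfData_odd b hb (o := 5) (by norm_num) ⟨2, by norm_num⟩, coeffU_eq_rawSum]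
  ring

/-- **`Q(b)` IS AN INVARIANT OF THE COMMON JET GROUP**: on the polytope with an admissible partner, the `Q`-minor computed from
`T_t(pfData b)` is `t₀²·minorQCore b` for every truncated jet operator `T_t`. -/
theorem minorQCore_jetOp_invariant (b : ℕ → ℤ) (hb : InPolytope b) (hj : ∃ j, 1 ≤ j ∧ j ≤ 7 ∧ InPolytope (shift b j))
    (t : ℕ → ℚ) : rawMinorQ (b 0).toNat (b 0) (jetOp t (pfData b)) = t 0 ^ 2 * minorQCore b := by
  rw [minorQCore_eq_rawMinorQ]
  exact rawMinorQ_jetOp _ _ t _ (rawSum_pfData_odd b hb (by norm_num) ⟨1, by norm_num⟩)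
    (rawSum_pfData_odd b hb (by norm_num) ⟨2, by norm_num⟩)
    (rawSum_coreData_odd b hb hj (by norm_num) ⟨1, by norm_num⟩)
    (rawSum_coreData_odd b hb hj (by norm_num) ⟨2, by norm_num⟩)

/-- **The deflated `W`-sum `D(b) = W^core − r_U·W` is an invariant of the common jet group** (`t₀ = 1`, `U(b) ≠ 0`). -/
theorem deflW_jetOp_invariant (b : ℕ → ℤ) (hb : InPolytope b) (hj : ∃ j, 1 ≤ j ∧ j ≤ 7 ∧ InPolytope (shift b j))
    (t : ℕ → ℚ) (ht : t 0 = 1) (hU : coeffU b ≠ 0) :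
    rawDeflW (b 0).toNat (b 0) (jetOp t (pfData b)) = rawDeflW (b 0).toNat (b 0) (pfData b) :=
  rawDeflW_jetOp _ _ t _ ht (by rwa [← coeffU_eq_rawSum]) (rawSum_pfData_odd b hb (by norm_num) ⟨1, by norm_num⟩)
    (rawSum_pfData_odd b hb (by norm_num) ⟨2, by norm_num⟩)
    (rawSum_coreData_odd b hb hj (by norm_num) ⟨1, by norm_num⟩)
    (rawSum_coreData_odd b hb hj (by norm_num) ⟨2, by norm_num⟩)

end Summit.KontsevichZagierPeriods.Zeta5Search.RVFlatGauge

end
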